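import Summits.RiemannHypothesis.RiemannHypothesis.Theorems.EarlyAppointmentsRemainder0XiKernelShiftSum
import Summits.RiemannHypothesis.RiemannHypothesis.Theorems.EarlyAppointmentsRemainder0XiKernelLowSide
import Summits.RiemannHypothesis.RiemannHypothesis.Theorems.EarlyAppointmentsRemainder0XiKernelHighMain
import Summits.RiemannHypothesis.RiemannHypothesis.Theorems.EarlyAppointmentsRemainder0XiKernelShiftNumerics

/-!
# ⟨24730⟩ ρ2 v4 — LEAF 1 CLOSED: `kernelShiftLeaf_of (K) (hK : 0.0105 ≤ K.cS) : KernelShiftLeaf K`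

C4 «kernel desk» rh-idea-6 g31 (successor of g30), director (CA406)(d).  SUPPORT module for crux r3 `Remainder0Xi`
(stmt-RiemannHypothesis-24730), line `rho2_v4`, stub `stub_farAbel4` (via `FarAbelSkeleton.farAbel4_of_leaves` / C3 g41's
`LedgerLeaf4KTables.farAbel4_of_three_leaves_K4C|_affine`).  Fully proved, standard axioms.  Imports the four pre-images
…KernelShiftSum (`kernelShiftLeaf_of_heightBound`: LEAF 1 ⇐ an eventual bound on the real height sum
`Σᶠ_{ρ ∈ farBoxAt x T} ord·2/(x − Re ρ)²`), …KernelLowSide (lower Abel side), …KernelHighMain (⊇ …KernelHighSide; upper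
Brent–Platt–Trudgian side with the T-uniform main term) and …KernelShiftNumerics (the closed inequality
`leaf1Bound x ≤ 0.0105·log(γ/2π)`); lands after those four rows.

Assembly.  §1 `farBoxAt x T ⊆ heightBox 0 (x − 67.5) ∪ heightBox (x + 66.5) T` (the upper range starts one unit inside the
zero-free gap `|Re ρ − x| < 67.5`, so the closed far edge `Re ρ = x + 67.5` is covered with no boundary device), the two
height boxes are disjoint, all terms are `≥ 0`, hence (tree `finsum_mem_mono_set` + `finsum_mem_union`)
`far sum ≤ lower sum + upper sum` for EVERY `T`.  §2 lower sum `≤` main + envelope + `10⁻⁹` (…KernelLowSide, kernel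
`psiDn x t = 2/(x − t)²` is the summand).  §3 upper sum, re-indexed to Schoenfeld's `zerosBetween (x + 66.5) T`
(…HeightSumAbel, `2/(x − t)² = psiUp x t`), tends to BPT's limit `Fsq` after subtracting `(∫_{x+66.5}^T ψ·log(t/2π))/2π`;
so eventually it is `< Fsq + (T-uniform main bound) + ε ≤ envelope + tail + main + ε` (…KernelHighSide / …KernelHighMain).
§4 the three pieces are, term for term, `leaf1Bound x` (…KernelShiftNumerics), whence
`heightSum_eventually_le : ∀ᶠ T, far sum ≤ leaf1Bound x + ε`, `heightBound (c ≥ 0.0105)` and ★ `kernelShiftLeaf_of`.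
By-name line for the ρ2 lead / C3: `kernelShiftLeaf_of K4C (by norm_num [K4C]) : KernelShiftLeaf K4C` (and the same for
`K4W`, `cS = 11/1000`).  Nothing here bears on the truth of RH; RH is not proved; 24730 OPEN.
-/

noncomputable section

set_option linter.dupNamespace false

open Literature.NumberTheory.LFunctions

namespace Summit.RiemannHypothesis.RiemannHypothesis.Theorems.EarlyAppointmentsRemainder0Xi.KernelShiftLeafClose

open Set MeasureTheory Real Filter Topology
open Literature.NumberTheory.LFunctions.SchoenfeldBound (zerosBetween)
open Summit.RiemannHypothesis.RiemannHypothesis.Cruxes.Remainder0Xi.Rho2V2 (T_PT boxHalfWidth lowStart)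
open Summit.RiemannHypothesis.RiemannHypothesis.Theorems.Splittings.EarlyAppointmentsXiZetaDictionary (finsum_mem_mono_set)
open Summit.RiemannHypothesis.RiemannHypothesis.Theorems.EarlyAppointmentsRemainder0Xi.FarAbelSkeleton
  (farBoxAt LeafConsts KernelShiftLeaf)
open Summit.RiemannHypothesis.RiemannHypothesis.Theorems.EarlyAppointmentsRemainder0Xi.HeightSumAbel
  (heightBox heightBox_finite finsum_heights_eq_sum_zerosBetween)
open Summit.RiemannHypothesis.RiemannHypothesis.Theorems.EarlyAppointmentsRemainder0Xi.KernelShiftSum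
  (kernelShiftLeaf_of_heightBound)
open Summit.RiemannHypothesis.RiemannHypothesis.Theorems.EarlyAppointmentsRemainder0Xi.KernelLowSide
  (psiDn lowHalf_sq_bound integral_psiDn_log_le two_psiDn_edge)
open Summit.RiemannHypothesis.RiemannHypothesis.Theorems.EarlyAppointmentsRemainder0Xi.KernelHighSide
  (psiUp Fsq highSide_tendsto_sq abs_Fsq_le integral_psiUp_div_le two_psiUp_edge)
open Summit.RiemannHypothesis.RiemannHypothesis.Theorems.EarlyAppointmentsRemainder0Xi.KernelHighMain
  (integral_psiUp_log_div_le_uniform)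
open Summit.RiemannHypothesis.RiemannHypothesis.Theorems.EarlyAppointmentsRemainder0Xi.KernelShiftNumerics
  (leaf1Bound leaf1Bound_le)

/-! ## §1 The far box inside the two height ranges; the split bound -/

/-- the far box at `x` (all `Ξ`-zeros `ρ` with `0 < Re ρ ≤ T`, `|Re ρ − x| ≥ 67.5`) lies in `(0, x − 67.5] ∪ (x + 66.5, T]`. -/
theorem farBoxAt_subset_union (x T : ℝ) :
    farBoxAt x T ⊆ heightBox 0 (x - boxHalfWidth) ∪ heightBox (x + (boxHalfWidth - 1)) T := by
  rintro ρ ⟨h0, h1, h2, h3⟩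
  rcases le_abs'.1 h3 with h4 | h4
  · exact Or.inl ⟨h0, h1, by linarith⟩
  · exact Or.inr ⟨h0, by linarith, h2⟩

/-- … and the two height ranges are disjoint. -/
theorem disjoint_low_high' (x T : ℝ) :
    Disjoint (heightBox 0 (x - boxHalfWidth)) (heightBox (x + (boxHalfWidth - 1)) T) := by
  refine Set.disjoint_left.2 fun ρ h1 h2 ↦ ?_
  have a : ρ.re ≤ x - boxHalfWidth := h1.2.2
  have b : x + (boxHalfWidth - 1) < ρ.re := h2.2.1
  have hB : boxHalfWidth = 135 / 2 := rfl
  rw [hB] at a b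
  linarith

/-- the summand `ord(ρ)·2/(x − Re ρ)²` is nonnegative. -/
theorem summand_nonneg (x : ℝ) (ρ : ℂ) :
    0 ≤ ((analyticOrderAt riemannXiUpper ρ).toNat : ℝ) * (2 / (x - ρ.re) ^ 2) := by positivity

/-- ★ (K) the split bound, valid for every `T`: `far sum ≤ lower sum + upper sum`. -/
theorem farSum_le_low_add_high (x T : ℝ) :
    ∑ᶠ ρ ∈ farBoxAt x T, ((analyticOrderAt riemannXiUpper ρ).toNat : ℝ) * (2 / (x - ρ.re) ^ 2) ≤
      (∑ᶠ ρ ∈ heightBox 0 (x - boxHalfWidth), ((analyticOrderAt riemannXiUpper ρ).toNat : ℝ) * (2 / (x - ρ.re) ^ 2))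
      + ∑ᶠ ρ ∈ heightBox (x + (boxHalfWidth - 1)) T,
          ((analyticOrderAt riemannXiUpper ρ).toNat : ℝ) * (2 / (x - ρ.re) ^ 2) := by
  have hfin : (heightBox 0 (x - boxHalfWidth) ∪ heightBox (x + (boxHalfWidth - 1)) T).Finite :=
    (heightBox_finite _ _).union (heightBox_finite _ _)
  have h1 := finsum_mem_mono_set
    (f := fun ρ : ℂ ↦ ((analyticOrderAt riemannXiUpper ρ).toNat : ℝ) * (2 / (x - ρ.re) ^ 2))
    (farBoxAt_subset_union x T) hfin (summand_nonneg x)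
  rw [finsum_mem_union (disjoint_low_high' x T) (heightBox_finite _ _) (heightBox_finite _ _)] at h1
  exact h1

/-! ## §2 The lower sum -/

/-- ★ (K) the lower sum `≤ log((x − 67.5)/2π)·(2/67.5)/(2π) + W_N(x − 67.5)·4/67.5² + 10⁻⁹` for `x ≥ T_PT − 67.5`. -/
theorem low_le {x : ℝ} (hx : T_PT - boxHalfWidth ≤ x) :
    ∑ᶠ ρ ∈ heightBox 0 (x - boxHalfWidth), ((analyticOrderAt riemannXiUpper ρ).toNat : ℝ) * (2 / (x - ρ.re) ^ 2) ≤
      Real.log ((x - boxHalfWidth) / (2 * Real.pi)) * (2 / boxHalfWidth) / (2 * Real.pi)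
        + ((0.1038 * Real.log (x - boxHalfWidth) + 0.2573 * Real.log (Real.log (x - boxHalfWidth)) + 10.2425)
            * (4 / boxHalfWidth ^ 2) + 1 / 10 ^ 9) := by
  have h1 := lowHalf_sq_bound hx
  have h2 := integral_psiDn_log_le hx
  rw [two_psiDn_edge x] at h1
  have e : (∑ᶠ ρ ∈ heightBox 0 (x - boxHalfWidth), ((analyticOrderAt riemannXiUpper ρ).toNat : ℝ) * (2 / (x - ρ.re) ^ 2))
      = ∑ᶠ ρ ∈ heightBox 0 (x - boxHalfWidth), ((analyticOrderAt riemannXiUpper ρ).toNat : ℝ) * psiDn x ρ.re := by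
    simp only [psiDn]
  rw [e]
  have h3 := (abs_le.1 h1).2
  linarith

/-! ## §3 The upper sum -/

/-- the upper sum re-indexed to Schoenfeld's `zerosBetween` with BPT's kernel `ψ_up(t) = 2/(t − x)²`. -/
theorem high_eq {x T : ℝ} (hx : 0 ≤ x + (boxHalfWidth - 1)) :
    ∑ᶠ ρ ∈ heightBox (x + (boxHalfWidth - 1)) T, ((analyticOrderAt riemannXiUpper ρ).toNat : ℝ) * (2 / (x - ρ.re) ^ 2) =
      ∑ ρ ∈ zerosBetween (x + (boxHalfWidth - 1)) T, (riemannZetaZeroOrder ρ : ℝ) * psiUp x ρ.im := by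
  rw [← finsum_heights_eq_sum_zerosBetween hx (psiUp x)]
  refine finsum_mem_congr rfl fun ρ _ ↦ ?_
  simp only [psiUp]
  rw [show (x - ρ.re) ^ 2 = (ρ.re - x) ^ 2 by ring]

/-- ★ (K) the upper sum is EVENTUALLY (in `T`) at most `main + W_N(x + 66.5)·4/66.5² + tail + ε`. -/
theorem high_eventually {x ε : ℝ} (hx : T_PT - boxHalfWidth ≤ x) (hε : 0 < ε) :
    ∀ᶠ T : ℝ in atTop,
      ∑ᶠ ρ ∈ heightBox (x + (boxHalfWidth - 1)) T, ((analyticOrderAt riemannXiUpper ρ).toNat : ℝ) * (2 / (x - ρ.re) ^ 2) ≤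
        (2 * Real.log ((x + (boxHalfWidth - 1)) / (2 * Real.pi)) / ((x + (boxHalfWidth - 1)) - x)
            + 2 / x * Real.log ((x + (boxHalfWidth - 1)) / ((x + (boxHalfWidth - 1)) - x))) / (2 * Real.pi)
        + (0.1038 * Real.log (x + (boxHalfWidth - 1)) + 0.2573 * Real.log (Real.log (x + (boxHalfWidth - 1))) + 10.2425)
            * (4 / (boxHalfWidth - 1) ^ 2)
        + (0.1038 + 0.2573 / Real.log (x + (boxHalfWidth - 1)))
            * (2 / (((x + (boxHalfWidth - 1)) - x) * (x + (boxHalfWidth - 1))))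
        + ε := by
  have hT : T_PT = 3000175332800 := rfl
  have hB : boxHalfWidth = 135 / 2 := rfl
  have hx' := hx
  rw [hT, hB] at hx'
  have hx0 : 0 < x := by linarith
  have hxT : x < x + (boxHalfWidth - 1) := by rw [hB]; linarith
  have h3 : (3 : ℝ) ≤ x + (boxHalfWidth - 1) := by rw [hB]; linarith
  have h1T : (1 : ℝ) < x + (boxHalfWidth - 1) := by linarith
  have he : Real.exp 1 ≤ x + (boxHalfWidth - 1) := by
    have := Real.exp_one_lt_d9
    rw [hB]
    linarith
  have h2π : 2 * π ≤ x + (boxHalfWidth - 1) := by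
    have := Real.pi_lt_four
    rw [hB]
    linarith
  have hpos : 0 ≤ x + (boxHalfWidth - 1) := by linarith
  have htend := highSide_tendsto_sq hxT h3
  have hF := (abs_le.1 (abs_Fsq_le hxT h3 he)).2
  have hI := integral_psiUp_div_le hxT (by linarith : 0 < x + (boxHalfWidth - 1))
  have hedge := two_psiUp_edge x (boxHalfWidth - 1)
  have hlt : Fsq x (x + (boxHalfWidth - 1)) < Fsq x (x + (boxHalfWidth - 1)) + ε := by linarith
  filter_upwards [htend.eventually (eventually_lt_nhds hlt), eventually_ge_atTop (x + (boxHalfWidth - 1))]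
    with T h1 h2
  have hmain := integral_psiUp_log_div_le_uniform hx0 hxT h2 h2π
  rw [high_eq hpos]
  have hcoef0 : 0 ≤ 0.1038 + 0.2573 / Real.log (x + (boxHalfWidth - 1)) := by
    have : 0 < Real.log (x + (boxHalfWidth - 1)) := Real.log_pos h1T
    positivity
  have hI' := mul_le_mul_of_nonneg_left hI hcoef0
  have hW : 2 * (0.1038 * Real.log (x + (boxHalfWidth - 1)) + 0.2573 * Real.log (Real.log (x + (boxHalfWidth - 1)))
        + 10.2425) * psiUp x (x + (boxHalfWidth - 1))
      = (0.1038 * Real.log (x + (boxHalfWidth - 1)) + 0.2573 * Real.log (Real.log (x + (boxHalfWidth - 1))) + 10.2425)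
        * (4 / (boxHalfWidth - 1) ^ 2) := by
    rw [← hedge]
    ring
  linarith

/-! ## §4 Assembly: the far height sum is eventually `≤ leaf1Bound x + ε`, and LEAF 1 -/

/-- ★ (K) for `γ > T_PT`, `|x − γ| ≤ 67.5`, `ε > 0`: eventually in `T`, `Σᶠ_{ρ ∈ farBoxAt x T} ord·2/(x − Re ρ)² ≤ leaf1Bound x + ε`. -/
theorem heightSum_eventually_le {γ x ε : ℝ} (hγ : T_PT < γ) (hxγ : |x - γ| ≤ boxHalfWidth) (hε : 0 < ε) :
    ∀ᶠ T : ℝ in atTop,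
      ∑ᶠ ρ ∈ farBoxAt x T, ((analyticOrderAt riemannXiUpper ρ).toNat : ℝ) * (2 / (x - ρ.re) ^ 2)
        ≤ leaf1Bound x + ε := by
  have hx : T_PT - boxHalfWidth ≤ x := by
    have := (abs_le.1 hxγ).1
    linarith
  filter_upwards [high_eventually hx hε] with T hT
  have h1 := farSum_le_low_add_high x T
  have h2 := low_le hx
  unfold leaf1Bound
  linarith

/-- ★ (K) the height-sum hypothesis of `kernelShiftLeaf_of_heightBound`, for every slope `c ≥ 0.0105`. -/
theorem heightBound {c : ℝ} (hc : 105 / 10000 ≤ c) :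
    ∀ γ : ℝ, T_PT < γ → ∀ x : ℝ, |x - γ| ≤ boxHalfWidth → ∀ ε : ℝ, 0 < ε → ∀ᶠ T : ℝ in Filter.atTop,
      ∑ᶠ ρ ∈ farBoxAt x T, ((analyticOrderAt riemannXiUpper ρ).toNat : ℝ) * (2 / (x - ρ.re) ^ 2)
        ≤ c * Real.log (γ / (2 * Real.pi)) + ε := by
  intro γ hγ x hx ε hε
  have hnum := leaf1Bound_le hγ hx
  have hL : 0 ≤ Real.log (γ / (2 * Real.pi)) := by linarith [RegistryForm.log_div_twoPi_ge hγ]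
  have hcL := mul_le_mul_of_nonneg_right hc hL
  filter_upwards [heightSum_eventually_le hγ hx hε] with T hT
  linarith

/-- ★★ (K) **LEAF 1 of `FarAbel4` CLOSED**: `KernelShiftLeaf K` for every table of constants with `K.cS ≥ 0.0105`
(C3 g41's `K4C`: `cS = 105/10000`; `K4W`: `cS = 11/1000`).  The complex-to-real kernel shift of the far pair sum at the
box `|Re w − γ| ≤ 67.5`, `|Im w| ≤ 1/2`, `γ > T_PT`, costs at most `0.0105·log(γ/2π) + ε`, eventually in the truncation
height. -/
theorem kernelShiftLeaf_of (K : LeafConsts) (hK : 105 / 10000 ≤ K.cS) : KernelShiftLeaf K :=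
  kernelShiftLeaf_of_heightBound K (heightBound hK)

end Summit.RiemannHypothesis.RiemannHypothesis.Theorems.EarlyAppointmentsRemainder0Xi.KernelShiftLeafClose

end
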